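import Summits.Ventures.PercRepro.S2TwoAvoidingCircuits

/-!
# PercRepro — S2: TWO AVOIDING CIRCUITS OF SIZE `≤ 4` FROM SIX TRIANGLES (p7, gen 14; sub-claim S2; Lemma A′ sharpened)

`S2.exists_two_circuits_le_four_disjoint_of_seven` needs `≥ 7` triangles; the spread case of `(14, 7)` at `t = 6` triangles
needs the same conclusion (`816 · 6` is too much, `530 · 6` is not). With `6` triangles and a triangle `T`: either two triangles
avoid `T`; or exactly one, `D`, does, and the four further triangles meeting `T` give a point of `T` with two of them, whose
quadruple `Q` is a `4`-circuit `≠ D`; or none does, and the five further triangles give two points with two each, whose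
quadruples are distinct. **`exists_two_circuits_le_four_disjoint_of_six`**. Axioms: standard.
-/

open scoped Matroid

namespace PercRepro

namespace S2

open Set

variable {α : Type}

/-- **Two distinct circuits of size `≤ 4` avoid every triangle** once the matroid carries `≥ 6` triangles (spread simple
core). -/
theorem exists_two_circuits_le_four_disjoint_of_six (M : Matroid α) [M.Finite]
    (hC1 : ∀ L ⊆ M.E, M.eRk L = 2 → L.ncard ≤ 3)
    (hs : ∀ e ∈ M.E, ∀ f ∈ M.E, e ≠ f → M.eRk {e, f} = 2)
    (h9 : ∀ X ⊆ M.E, X.ncard ≤ 9 → X.encard ≤ M.eRk X + 3)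
    (h6 : 6 ≤ {C : Set α | M.IsCircuit C ∧ C.ncard = 3}.ncard)
    {T : Set α} (hT : M.IsCircuit T) (hT3 : T.ncard = 3) :
    ∃ D₁ D₂ : Set α, M.IsCircuit D₁ ∧ D₁.ncard ≤ 4 ∧ Disjoint D₁ T ∧
      M.IsCircuit D₂ ∧ D₂.ncard ≤ 4 ∧ Disjoint D₂ T ∧ D₁ ≠ D₂ := by
  classical
  set 𝒯 := {C : Set α | M.IsCircuit C ∧ C.ncard = 3} with h𝒯
  have h𝒯fin : 𝒯.Finite := M.ground_finite.finite_subsets.subset (fun C hC => hC.1.subset_ground)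
  set 𝒟 := {C : Set α | M.IsCircuit C ∧ C.ncard = 3 ∧ Disjoint C T} with h𝒟
  have h𝒟fin : 𝒟.Finite := h𝒯fin.subset (fun C hC => ⟨hC.1, hC.2.1⟩)
  by_cases h2 : 2 ≤ 𝒟.ncard
  · obtain ⟨T', T'', hT', hT'', hne⟩ := (Set.one_lt_ncard_iff h𝒟fin).1 (by omega)
    exact ⟨T', T'', hT'.1, by rw [hT'.2.1]; norm_num, hT'.2.2, hT''.1, by rw [hT''.2.1]; norm_num,
      hT''.2.2, hne⟩
  push Not at h2
  -- the triangles through a point `u ∈ T` other than `T`: at most `2`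
  have hfinS : ∀ w : α, ({T' ∈ 𝒯 | T' ≠ T ∧ w ∈ T'} : Set (Set α)).Finite :=
    fun _ => h𝒯fin.subset (fun C hC => hC.1)
  have hthrough : ∀ u ∈ T, ({T' ∈ 𝒯 | T' ≠ T ∧ u ∈ T'} : Set (Set α)).ncard ≤ 2 := by
    intro u huT
    by_contra hlt
    push Not at hlt
    obtain ⟨T₂, T₃, T₄, h2, h3, h4, h23, h24, h34⟩ := (Set.two_lt_ncard_iff (hfinS u)).1 hlt
    exact not_four_triangles_through M hC1 h9 hT hT3 huT h2.1.1 h2.1.2 h2.2.2 h3.1.1 h3.1.2 h3.2.2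
      h4.1.1 h4.1.2 h4.2.2 (Ne.symm h2.2.1) (Ne.symm h3.2.1) (Ne.symm h4.2.1) h23 h24 h34
  -- a point carrying two further triangles gives a `4`-circuit avoiding `T` with the point in its closure
  have hpair : ∀ u ∈ T, 2 ≤ ({T' ∈ 𝒯 | T' ≠ T ∧ u ∈ T'} : Set (Set α)).ncard →
      ∃ Q : Set α, M.IsCircuit Q ∧ Q.ncard = 4 ∧ Disjoint Q T ∧ u ∈ M.closure Q := by
    intro u hu h2u
    obtain ⟨T', T'', hT', hT'', hne⟩ := (Set.one_lt_ncard_iff (hfinS u)).1 (by omega)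
    exact exists_four_circuit_of_two_triangles_through M hC1 hs hT hT3 hT'.1.1 hT'.1.2 hT''.1.1 hT''.1.2
      hT'.2.1 hT''.2.1 hne hu hT'.2.2 hT''.2.2
  have hmain : ∀ u ∈ T, ∀ v ∈ T, u ≠ v → 2 ≤ ({T' ∈ 𝒯 | T' ≠ T ∧ u ∈ T'} : Set (Set α)).ncard →
      2 ≤ ({T' ∈ 𝒯 | T' ≠ T ∧ v ∈ T'} : Set (Set α)).ncard →
      ∃ D₁ D₂ : Set α, M.IsCircuit D₁ ∧ D₁.ncard ≤ 4 ∧ Disjoint D₁ T ∧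
        M.IsCircuit D₂ ∧ D₂.ncard ≤ 4 ∧ Disjoint D₂ T ∧ D₁ ≠ D₂ := by
    intro u hu v hv huv h2u h2v
    obtain ⟨Qu, hQu, hQu4, hQuT, huQ⟩ := hpair u hu h2u
    obtain ⟨Qv, hQv, hQv4, hQvT, hvQ⟩ := hpair v hv h2v
    exact ⟨Qu, Qv, hQu, hQu4.le, hQuT, hQv, hQv4.le, hQvT,
      four_circuits_ne_of_closure_mem M h9 hT hT3 hu hv huv hQu hQu4 hQuT huQ hQv hvQ⟩
  -- one avoiding triangle `D` and a point carrying two further triangles: its quadruple is a second circuit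
  have hone : ∀ u ∈ T, 2 ≤ ({T' ∈ 𝒯 | T' ≠ T ∧ u ∈ T'} : Set (Set α)).ncard → ∀ D ∈ 𝒟,
      ∃ D₁ D₂ : Set α, M.IsCircuit D₁ ∧ D₁.ncard ≤ 4 ∧ Disjoint D₁ T ∧
        M.IsCircuit D₂ ∧ D₂.ncard ≤ 4 ∧ Disjoint D₂ T ∧ D₁ ≠ D₂ := by
    intro u hu h2u D hD
    obtain ⟨Q, hQ, hQ4, hQT, -⟩ := hpair u hu h2u
    refine ⟨Q, D, hQ, hQ4.le, hQT, hD.1, by rw [hD.2.1]; norm_num, hD.2.2, fun heq => ?_⟩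
    rw [heq, hD.2.1] at hQ4
    omega
  -- the cover of the triangles by `T`, the three through-families and the avoiding ones
  obtain ⟨x, y, z, hxy, hxz, hyz, hTxyz⟩ := Set.ncard_eq_three.1 hT3
  have hxT : x ∈ T := by rw [hTxyz]; exact Set.mem_insert x _
  have hyT : y ∈ T := by rw [hTxyz]; exact Set.mem_insert_of_mem x (Set.mem_insert y _)
  have hzT : z ∈ T := by
    rw [hTxyz]; exact Set.mem_insert_of_mem x (Set.mem_insert_of_mem y (Set.mem_singleton z))
  set Sx := ({T' ∈ 𝒯 | T' ≠ T ∧ x ∈ T'} : Set (Set α)) with hSx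
  set Sy := ({T' ∈ 𝒯 | T' ≠ T ∧ y ∈ T'} : Set (Set α)) with hSy
  set Sz := ({T' ∈ 𝒯 | T' ≠ T ∧ z ∈ T'} : Set (Set α)) with hSz
  have hcover : 𝒯 ⊆ ({T} ∪ ((Sx ∪ Sy) ∪ Sz)) ∪ 𝒟 := by
    intro T' hT'
    by_cases hne : T' = T
    · exact Or.inl (Or.inl (Set.mem_singleton_iff.2 hne))
    by_cases hdis : Disjoint T' T
    · exact Or.inr ⟨hT'.1, hT'.2, hdis⟩
    · rw [Set.not_disjoint_iff] at hdis
      obtain ⟨w, hwT', hwT⟩ := hdis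
      rw [hTxyz] at hwT
      simp only [Set.mem_insert_iff, Set.mem_singleton_iff] at hwT
      rcases hwT with rfl | rfl | rfl
      · exact Or.inl (Or.inr (Or.inl (Or.inl ⟨hT', hne, hwT'⟩)))
      · exact Or.inl (Or.inr (Or.inl (Or.inr ⟨hT', hne, hwT'⟩)))
      · exact Or.inl (Or.inr (Or.inr ⟨hT', hne, hwT'⟩))
  have hle := Set.ncard_le_ncard hcover
    (((Set.finite_singleton T).union (((hfinS x).union (hfinS y)).union (hfinS z))).union h𝒟fin)
  have hu1 := Set.ncard_union_le ({T} ∪ ((Sx ∪ Sy) ∪ Sz)) 𝒟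
  have hu2 := Set.ncard_union_le ({T} : Set (Set α)) ((Sx ∪ Sy) ∪ Sz)
  have hu3 := Set.ncard_union_le (Sx ∪ Sy) Sz
  have hu4 := Set.ncard_union_le Sx Sy
  rw [Set.ncard_singleton] at hu2
  have hx2 : Sx.ncard ≤ 2 := hthrough x hxT
  have hy2 : Sy.ncard ≤ 2 := hthrough y hyT
  have hz2 : Sz.ncard ≤ 2 := hthrough z hzT
  by_cases h1 : 𝒟.ncard = 1
  · -- exactly one avoiding triangle: some point of `T` carries two further triangles
    obtain ⟨D, hD⟩ := Set.ncard_eq_one.1 h1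
    have hD𝒟 : D ∈ 𝒟 := by rw [hD]; exact Set.mem_singleton D
    rcases (by omega : 2 ≤ Sx.ncard ∨ 2 ≤ Sy.ncard ∨ 2 ≤ Sz.ncard) with ha | hb | hc
    · exact hone x hxT ha D hD𝒟
    · exact hone y hyT hb D hD𝒟
    · exact hone z hzT hc D hD𝒟
  · -- no avoiding triangle: two points of `T` carry two further triangles each
    rcases (by omega : (2 ≤ Sx.ncard ∧ 2 ≤ Sy.ncard) ∨ (2 ≤ Sx.ncard ∧ 2 ≤ Sz.ncard) ∨
        (2 ≤ Sy.ncard ∧ 2 ≤ Sz.ncard)) with ⟨ha, hb⟩ | ⟨ha, hc⟩ | ⟨hb, hc⟩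
    · exact hmain x hxT y hyT hxy ha hb
    · exact hmain x hxT z hzT hxz ha hc
    · exact hmain y hyT z hzT hyz hb hc

end S2

end PercRepro
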